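import Literature.Barriers.RiemannHypothesis.EpsteinZetaRealZerosDHVocabulary
import Literature.NumberTheory.LFunctions.RayClassLSeriesNonvanishing
import Literature.NumberTheory.LFunctions.RayClassLSeriesAtOneLimitProofs
import HarnessLib

/-!
# Davenport–Heilbronn for Epstein zeta functions, II: prime sums of class characters near `s = 1`
# (Dirichlet density `1/h` of every ideal class)

Sibling of `Literature/Barriers/RiemannHypothesis/EpsteinZetaRealZeros.lean` (named fact
`DavenportHeilbronn1936b_epstein`). Everything in this file is PROVED; no definitions, no named facts.
For a number field `K` with class group `Cl(K)` of order `h` and the datum `𝔭 ↦ [𝔭]`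
(`DHEpstein.primeClass`, `EpsteinZetaRealZerosDHVocabulary.lean`), write
`D_χ(s) = ∑_{deg 𝔭 = 1} χ([𝔭]) N𝔭^{-s}` (the tree's `∑' v, primeTerm (charCoeff ⊤ primeClass χ) s v`,
`AbelianFrobeniusDensity.lean`) for a character `χ` of `Cl(K)` and real `s > 1`. We prove the
real-variable input of Davenport–Heilbronn I, Lemma 1 ("It is known that, for `χ ≠ χ₀`, `L(s, χ)`
is regular at `s = 1`, and `L(1, χ) ≠ 0`, also that `L(s, χ₀)` has a simple pole at `s = 1`", §4;
used in §2 as "`∑_p χ(p) p^{-s} = log L(s, χ) + O(1) = O(1)`" for `χ ≠ χ₀` and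
"`= log 1/(s−1) + O(1)`" for `χ₀`):

* `tendsto_primeTerm_of_isRayClassCharacter` — for every modulus `𝔪 ≠ 0` and every NON-PRINCIPAL
  ray class character `χ mod 𝔪`, the degree-one prime sum `∑_{deg 𝔭 = 1, 𝔭 ∤ 𝔪} χ(𝔭) N𝔭^{-s}`
  CONVERGES as `s → 1⁺` (Hecke–Landau `L(1, χ) ≠ 0`, the tree's
  `exists_entire_eq_rayClassLSeries_and_apply_one_ne_zero`, with `log L = ∑_𝔭 + O(1)` and the
  continuous-logarithm lemma of `AbelianFrobeniusDensity.lean`);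
* `tendsto_charPrimeSum` — in particular `D_χ(s)` converges for `χ ≠ 1`;
* `tendsto_charPrimeSum_zero_add_log` — `D_1(s) + log (s − 1)` converges (pole of `ζ_K`);
* `hasStrongDirichletDensity_primeClass` — **every ideal class has strong Dirichlet density `1/h`**:
  `∑_{deg 𝔭 = 1, [𝔭] = g} N𝔭^{-s} + (1/h) log (s − 1)` converges as `s → 1⁺` (orthogonality;
  Dirichlet–Dedekind–Weber, Landau 1918 "Über Ideale und Primideale in Idealklassen" — the theorem
  D–H II §4 quote in its de la Vallée-Poussin form), obtained from the tree's conditional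
  `AbelianDensity.hasStrongDirichletDensity_frobFiber_of_generate` by discharging its density
  hypothesis for the principal class with the two limits above.

## References

* [DavenportHeilbronn1936a] H. Davenport, H. Heilbronn, *On the zeros of certain Dirichlet series I*,
  J. London Math. Soc. 11 (1936), 181–185, §2 Lemma 1 and §4.
* [DavenportHeilbronn1936b] — *II*, ibid. 307–312, §4 (primes in ideal classes, after de la
  Vallée-Poussin 1897 and Landau 1918).
* [HeilbronnZetaL1967] H. Heilbronn, *Zeta-functions and L-functions*, Ch. VIII of Cassels–Fröhlich,
  §2, Note after Theorem 5 (the real-variable argument followed by `AbelianFrobeniusDensity.lean`).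
-/

noncomputable section

open Filter Topology Complex NumberField IsDedekindDomain
open Literature.NumberTheory.LFunctions Literature.NumberTheory.LFunctions.AbelianDensity
open scoped nonZeroDivisors

namespace Literature.Barriers.RiemannHypothesis

namespace DHEpstein

variable {K : Type*} [Field K] [NumberField K]

/-! ## Non-principal ray class characters: the degree-one prime sum converges at `s = 1` -/

/-- `exp E_a(s) = L(χ, s)` for `a = ψ'` the prime values of a ray class character (`s > 1`).
[folklore] -/
theorem cexp_logEuler_rayClassPrimeValue {𝔪 : Ideal (𝓞 K)} (h𝔪 : 𝔪 ≠ ⊥)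
    {ψ : HeightOneSpectrum (𝓞 K) → ℂ}
    (hψ : ∀ v : HeightOneSpectrum (𝓞 K), ¬ 𝔪 ≤ v.asIdeal → ‖ψ v‖ ≤ 1) {s : ℝ} (hs : 1 < s) :
    cexp (logEuler (rayClassPrimeValue 𝔪 ψ) s) = rayClassLSeries 𝔪 ψ (s : ℂ) := by
  have ha : ∀ v, ‖rayClassPrimeValue 𝔪 ψ v‖ ≤ 1 := norm_rayClassPrimeValue_le hψ
  have h1 := hasProd_cexp_logEuler ha hs
  have h2 := hasProd_rayClassLSeries_rayClassPrimeValue h𝔪 hψ (s := (s : ℂ)) (by simpa using hs)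
  have h3 : HasProd (fun v : HeightOneSpectrum (𝓞 K) ↦ (1 - zterm (rayClassPrimeValue 𝔪 ψ) s v)⁻¹)
      (rayClassLSeries 𝔪 ψ (s : ℂ)) := by
    refine h2.congr_fun fun v ↦ ?_
    unfold zterm npow
    congr 3
    rw [Complex.ofReal_cpow (Nat.cast_nonneg _) (-s)]
    push_cast
    rfl
  exact h1.unique h3

/-- **The degree-one prime sum of a non-principal ray class character converges at `s = 1`**
(Davenport–Heilbronn I §2: "`∑_p χ(p) p^{-s} = log L(s, χ) + O(1) = O(1)`" for `χ ≠ χ₀`; here with a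
genuine limit): for `𝔪 ≠ 0` and a ray class character `χ mod 𝔪` with `χ(𝔭) ≠ 1` for some `𝔭 ∤ 𝔪`,
`∑_{deg 𝔭 = 1, 𝔭 ∤ 𝔪} χ(𝔭) N𝔭^{-s}` tends to a limit as `s → 1⁺`. Inputs: Hecke–Landau
`L(1, χ) ≠ 0` and the regularity of `L(s, χ)` at `1` (tree), `log L(s,χ) = ∑_𝔭 χ(𝔭)N𝔭^{-s} + O(1)`.
[cite: DavenportHeilbronn1936a, §2 Lemma 1 and §4] -/
theorem tendsto_primeTerm_of_isRayClassCharacter {𝔪 : Ideal (𝓞 K)} (h𝔪 : 𝔪 ≠ ⊥)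
    {ψ : HeightOneSpectrum (𝓞 K) → ℂ} (hψ : IsRayClassCharacter 𝔪 ψ)
    (hnt : ∃ v : HeightOneSpectrum (𝓞 K), ¬ 𝔪 ≤ v.asIdeal ∧ ψ v ≠ 1) :
    ∃ d : ℂ, Tendsto (fun s : ℝ ↦ ∑' v, primeTerm (rayClassPrimeValue 𝔪 ψ) s v) (𝓝[>] 1) (𝓝 d) := by
  have hψle : ∀ v : HeightOneSpectrum (𝓞 K), ¬ 𝔪 ≤ v.asIdeal → ‖ψ v‖ ≤ 1 :=
    fun v hv ↦ (hψ.norm_eq_one v hv).le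
  set a := rayClassPrimeValue 𝔪 ψ with ha_def
  have ha : ∀ v, ‖a v‖ ≤ 1 := norm_rayClassPrimeValue_le hψle
  -- `E = D + R`, `exp E = L`, `R` converges
  have hE : ∀ s : ℝ, 1 < s → logEuler a s = (∑' v, primeTerm a s v) + ∑' v, remTerm a s v :=
    fun s hs ↦ logEuler_eq_add ha hs
  have hexpE : ∀ s : ℝ, 1 < s → cexp (logEuler a s) = rayClassLSeries 𝔪 ψ (s : ℂ) :=
    fun s hs ↦ cexp_logEuler_rayClassPrimeValue h𝔪 hψle hs
  have hRt : Tendsto (fun s : ℝ ↦ ∑' v, remTerm a s v) (𝓝[>] 1) (𝓝 (∑' v, remTerm a 1 v)) :=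
    tendsto_tsum_remTerm ha
  -- the limit of `L(s, χ)` and its non-vanishing
  obtain ⟨c, hc⟩ := rayClassLSeries_tendsto_nhdsGT_one_holds (K := K) 𝔪 h𝔪 ψ hψ hnt
  obtain ⟨g, hg, hgs, hg1⟩ := exists_entire_eq_rayClassLSeries_and_apply_one_ne_zero h𝔪 hψ hnt
  have hc1 : c = g 1 := by
    have h1 : Tendsto (fun s : ℝ ↦ g (s : ℂ)) (𝓝[>] 1) (𝓝 (g 1)) := by
      have := ((hg.continuous.comp Complex.continuous_ofReal).tendsto (1 : ℝ)).mono_left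
        (nhdsWithin_le_nhds (s := Set.Ioi (1 : ℝ)))
      simp only [Function.comp_def, Complex.ofReal_one] at this
      exact this
    have h2 : Tendsto (fun s : ℝ ↦ g (s : ℂ)) (𝓝[>] 1) (𝓝 c) := by
      refine hc.congr' ?_
      filter_upwards [self_mem_nhdsWithin] with s hs
      exact (hgs (s : ℂ) (by simpa using hs)).symm
    exact tendsto_nhds_unique h2 h1
  have hc0 : c ≠ 0 := hc1 ▸ hg1
  -- continuous logarithm
  obtain ⟨e, he⟩ := exists_tendsto_of_cexp_eq (continuousOn_logEuler ha) hexpE hc hc0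
  refine ⟨e - ∑' v, remTerm a 1 v, (he.sub hRt).congr' ?_⟩
  filter_upwards [self_mem_nhdsWithin] with s hs
  rw [hE s hs]
  ring

/-! ## Class characters -/

omit [NumberField K] in
/-- No prime ideal contains `⊤`, so the modulus `(1) = ⊤` excludes no prime. [folklore] -/
theorem not_top_le (v : HeightOneSpectrum (𝓞 K)) : ¬ (⊤ : Ideal (𝓞 K)) ≤ v.asIdeal :=
  fun h ↦ v.isPrime.ne_top (top_le_iff.1 h)

/-- A non-trivial character of `Cl(K)` is `≠ 1` at the class of some prime (the prime classes
generate). [folklore] -/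
theorem exists_charFun_primeClass_ne_one (χ : AddChar (Additive (ClassGroup (𝓞 K))) ℂ) (hχ : χ ≠ 0) :
    ∃ v : HeightOneSpectrum (𝓞 K), ¬ (⊤ : Ideal (𝓞 K)) ≤ v.asIdeal ∧ charFun primeClass χ v ≠ 1 := by
  by_contra hall
  push Not at hall
  set H : Subgroup (ClassGroup (𝓞 K)) := (toMulHom χ).toHomUnits.ker with hH
  have hmem : ∀ g : ClassGroup (𝓞 K), g ∈ H ↔ χ (Additive.ofMul g) = 1 := fun g ↦ by
    rw [hH, MonoidHom.mem_ker, Units.ext_iff, MonoidHom.coe_toHomUnits, toMulHom_apply, Units.val_one]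
  have hHtop : H = ⊤ := primeClass_generate H fun v ↦
    (hmem (primeClass v)).mpr (by simpa [charFun] using hall v (not_top_le v))
  apply hχ
  rw [AddChar.eq_zero_iff]
  intro x
  have hx : Additive.toMul x ∈ H := by rw [hHtop]; exact Subgroup.mem_top _
  rw [hmem] at hx
  simpa only [ofMul_toMul] using hx

/-- **`D_χ(s) = ∑_{deg 𝔭 = 1} χ([𝔭]) N𝔭^{-s}` converges as `s → 1⁺` for every non-trivial character
`χ` of the class group** (D–H I §4: "`L(1, χ) ≠ 0`" for `χ ≠ χ₀`, whence
"`∑ χ(𝔭) N𝔭^{-s} = O(1)`"). [cite: DavenportHeilbronn1936a, §4] -/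
theorem tendsto_charPrimeSum (χ : AddChar (Additive (ClassGroup (𝓞 K))) ℂ) (hχ : χ ≠ 0) :
    ∃ d : ℂ, Tendsto (fun s : ℝ ↦ ∑' v, primeTerm (charCoeff ⊤ primeClass χ) s v) (𝓝[>] 1) (𝓝 d) :=
  tendsto_primeTerm_of_isRayClassCharacter top_ne_bot (isRayClassCharacter_primeClass ⊤ χ)
    (exists_charFun_primeClass_ne_one χ hχ)

/-- **`D_1(s) + log (s − 1)` converges as `s → 1⁺`** for the trivial character (`D_1(s)` is the
degree-one prime sum `∑_{deg 𝔭 = 1} N𝔭^{-s} = log ζ_K(s) + O(1)`; pole of `ζ_K`; D–H I §4: "`L(s, χ₀)`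
has a simple pole at `s = 1`"). [cite: DavenportHeilbronn1936a, §4] -/
theorem tendsto_charPrimeSum_zero_add_log :
    ∃ L₀ : ℝ, Tendsto (fun s : ℝ ↦ (∑' v, primeTerm (charCoeff ⊤ (primeClass (K := K)) 0) s v) +
      (Real.log (s - 1) : ℂ)) (𝓝[>] 1) (𝓝 (L₀ : ℂ)) := by
  obtain ⟨L₀, hL₀⟩ := id (hasStrongDirichletDensity_not_le (K := K) (𝔪 := ⊤) top_ne_bot)
  refine ⟨L₀, ((Complex.continuous_ofReal.tendsto L₀).comp hL₀).congr' ?_⟩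
  filter_upwards [self_mem_nhdsWithin] with s hs
  have ha : ∀ v, ‖charCoeff ⊤ (primeClass (K := K)) 0 v‖ ≤ 1 := fun v ↦ norm_charCoeff_le ⊤ primeClass 0 v
  have hDsum := hasSum_primeTerm_fiberwise ha hs
  have hcntB : ∀ p : Nat.Primes,
      |(primeNormCount K {v | ¬ (⊤ : Ideal (𝓞 K)) ≤ v.asIdeal} p : ℝ)| ≤ (2 : ℝ) ^ Module.finrank ℚ K :=
    fun p ↦ abs_primeNormCount_le _ p
  have h1 : HasSum (fun p : Nat.Primes ↦
      (primeNormCount K {v | ¬ (⊤ : Ideal (𝓞 K)) ≤ v.asIdeal} p : ℝ) * ((p : ℕ) : ℝ) ^ (-s))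
      (primeSeries (fun p ↦ (primeNormCount K {v | ¬ (⊤ : Ideal (𝓞 K)) ≤ v.asIdeal} p : ℝ)) s) := by
    rw [primeSeries]
    exact (summable_primes_mul_rpow_of_bounded
      (f := fun n ↦ (primeNormCount K {v | ¬ (⊤ : Ideal (𝓞 K)) ≤ v.asIdeal} n : ℝ)) hcntB hs).hasSum
  have h2 := Complex.hasSum_ofReal.mpr h1
  have hc0 : ∀ p : ℕ, (∑ v ∈ primesOfNorm K p, charCoeff ⊤ (primeClass (K := K)) 0 v) =
      (primeNormCount K {v | ¬ (⊤ : Ideal (𝓞 K)) ≤ v.asIdeal} p : ℂ) := fun p ↦ charCount_zero p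
  have hD0 : (∑' v, primeTerm (charCoeff ⊤ (primeClass (K := K)) 0) s v) =
      ((primeSeries (fun p ↦ (primeNormCount K {v | ¬ (⊤ : Ideal (𝓞 K)) ≤ v.asIdeal} p : ℝ)) s : ℝ) : ℂ) := by
    refine hDsum.unique (h2.congr_fun fun p ↦ ?_)
    rw [hc0 p]
    push_cast
    ring
  simp only [Function.comp_apply]
  rw [hD0]
  push_cast
  ring

/-! ## Dirichlet density `1/h` of every ideal class -/

/-- **The principal class has strong Dirichlet density `1/h`**: `∑_{deg 𝔭 = 1, 𝔭 principal} N𝔭^{-s}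
+ (1/h) log (s − 1)` converges as `s → 1⁺` (orthogonality: `h · ∑_{[𝔭] = 1} = ∑_χ D_χ`).
[cite: DavenportHeilbronn1936b, §4] -/
theorem hasStrongDirichletDensity_primeClass_one :
    HasStrongDirichletDensity K (frobFiber ⊤ (primeClass (K := K)) 1)
      (1 / Nat.card (ClassGroup (𝓞 K))) := by
  classical
  set G := ClassGroup (𝓞 K)
  set D : AddChar (Additive G) ℂ → ℝ → ℂ := fun χ s ↦ ∑' v, primeTerm (charCoeff ⊤ (primeClass (K := K)) χ) s v
    with hD
  have ha : ∀ (χ : AddChar (Additive G) ℂ) v, ‖charCoeff ⊤ (primeClass (K := K)) χ v‖ ≤ 1 :=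
    fun χ v ↦ norm_charCoeff_le ⊤ primeClass χ v
  have hcard0 : (Nat.card G : ℝ) ≠ 0 := Nat.cast_ne_zero.mpr Nat.card_pos.ne'
  have hcard0' : (Nat.card G : ℂ) ≠ 0 := Nat.cast_ne_zero.mpr Nat.card_pos.ne'
  -- the real prime series of the fibre, as a complex `HasSum`
  set cnt : ℕ → ℝ := fun p ↦ (primeNormCount K (frobFiber ⊤ (primeClass (K := K)) 1) p : ℝ) with hcnt
  have hcntB : ∀ p : Nat.Primes, |cnt p| ≤ (2 : ℝ) ^ Module.finrank ℚ K := fun p ↦ abs_primeNormCount_le _ p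
  have hreal : ∀ s : ℝ, 1 < s → HasSum (fun p : Nat.Primes ↦ ((cnt p * ((p : ℕ) : ℝ) ^ (-s) : ℝ) : ℂ))
      ((primeSeries cnt s : ℝ) : ℂ) := by
    intro s hs
    rw [primeSeries]
    exact Complex.hasSum_ofReal.mpr ((summable_primes_mul_rpow_of_bounded hcntB hs).hasSum)
  -- orthogonality: `∑_χ D_χ(s) = h · primeSeries cnt s`
  have hcomb : ∀ s : ℝ, 1 < s → ∑ χ, D χ s = (Nat.card G : ℂ) * ((primeSeries cnt s : ℝ) : ℂ) := by
    intro s hs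
    have h1 : HasSum (fun p : Nat.Primes ↦ ∑ χ : AddChar (Additive G) ℂ,
        charCount ⊤ primeClass χ p * ((((p : ℕ) : ℝ) ^ (-s) : ℝ) : ℂ)) (∑ χ, D χ s) :=
      hasSum_sum fun (χ : AddChar (Additive G) ℂ) _ ↦ hasSum_primeTerm_fiberwise (ha χ) hs
    have h2 : ∀ p : Nat.Primes, ∑ χ : AddChar (Additive G) ℂ,
        charCount ⊤ primeClass χ p * ((((p : ℕ) : ℝ) ^ (-s) : ℝ) : ℂ) =
          (Nat.card G : ℂ) * ((cnt p * ((p : ℕ) : ℝ) ^ (-s) : ℝ) : ℂ) := by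
      intro p
      rw [← Finset.sum_mul]
      have h := card_mul_primeNormCount (𝔪 := ⊤) (f := primeClass (K := K)) (1 : G) p
      simp only [ofMul_one, AddChar.map_zero_eq_one, inv_one, one_mul] at h
      rw [← h, hcnt]
      push_cast
      ring
    simp only [h2] at h1
    exact h1.unique ((hreal s hs).mul_left _)
  -- the limits of the `D_χ`
  obtain ⟨L₀, hL₀⟩ := tendsto_charPrimeSum_zero_add_log (K := K)
  set S : Finset (AddChar (Additive G) ℂ) := Finset.univ.erase 0 with hS
  have hdlim : ∀ χ ∈ S, ∃ d : ℂ, Tendsto (D χ) (𝓝[>] 1) (𝓝 d) := fun χ hχ ↦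
    tendsto_charPrimeSum χ (Finset.ne_of_mem_erase hχ)
  choose! d hd using hdlim
  have hsplit_sum : ∀ F : AddChar (Additive G) ℂ → ℂ, ∑ χ, F χ = F 0 + ∑ χ ∈ S, F χ := fun F ↦
    (Finset.add_sum_erase Finset.univ F (Finset.mem_univ 0)).symm
  have hT : Tendsto (fun s : ℝ ↦ ∑ χ, D χ s + (Real.log (s - 1) : ℂ)) (𝓝[>] 1)
      (𝓝 ((L₀ : ℂ) + ∑ χ ∈ S, d χ)) := by
    have h := hL₀.add (tendsto_finsetSum S fun χ hχ ↦ hd χ hχ)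
    refine h.congr' ?_
    filter_upwards with s
    rw [hsplit_sum (fun χ ↦ D χ s)]
    ring
  -- conclusion: the real prime series of the principal fibre
  refine ⟨((1 / (Nat.card G : ℂ)) * ((L₀ : ℂ) + ∑ χ ∈ S, d χ)).re, ?_⟩
  have hre := (Complex.continuous_re.tendsto _).comp (hT.const_mul (1 / (Nat.card G : ℂ)))
  refine hre.congr' ?_
  filter_upwards [self_mem_nhdsWithin] with s hs
  simp only [Function.comp_apply]
  have h3 : ((primeSeries cnt s : ℝ) : ℂ) = (1 / (Nat.card G : ℂ)) * ∑ χ, D χ s := by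
    rw [hcomb s hs]; field_simp
  have h4 : (1 / (Nat.card G : ℂ)) * (∑ χ, D χ s + (Real.log (s - 1) : ℂ)) =
      (((primeSeries cnt s + 1 / (Nat.card G : ℝ) * Real.log (s - 1) : ℝ)) : ℂ) := by
    rw [mul_add, ← h3]
    push_cast
    ring
  rw [h4, Complex.ofReal_re]

/-- **Every ideal class has strong Dirichlet density `1/h`** (Dirichlet–Dedekind–Weber; Landau 1918;
quoted in D–H II §4 in its de la Vallée-Poussin form "the number of primes `p` in `𝔏_j` not exceeding
`x` is asymptotically `(1/h(d)) x/log x`"; here the logarithmic form): for every `g ∈ Cl(K)`,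
`∑_{deg 𝔭 = 1, [𝔭] = g} N𝔭^{-s} + (1/h) log (s − 1)` converges as `s → 1⁺`. From the tree's
conditional equidistribution theorem `AbelianDensity.hasStrongDirichletDensity_frobFiber_of_generate`,
whose hypotheses are now all discharged: the datum `𝔭 ↦ [𝔭]` kills every ray, the prime classes
generate `Cl(K)`, the principal class has density `1/h` (above), and non-principal ray class
`L`-series are regular at `1` (`rayClassLSeries_tendsto_nhdsGT_one_holds`).
[cite: DavenportHeilbronn1936b, §4] -/
theorem hasStrongDirichletDensity_primeClass (g : ClassGroup (𝓞 K)) :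
    HasStrongDirichletDensity K (frobFiber ⊤ (primeClass (K := K)) g) (1 / Nat.card (ClassGroup (𝓞 K))) :=
  hasStrongDirichletDensity_frobFiber_of_generate top_ne_bot (artinKillsRay_primeClass ⊤)
    (fun H hH ↦ primeClass_generate H fun v ↦ hH v (not_top_le v))
    hasStrongDirichletDensity_primeClass_one (rayClassLSeries_tendsto_nhdsGT_one_holds K) g

/-- Membership in the fibre of the class datum: `[𝔭] = g`. [folklore] -/
theorem mem_frobFiber_primeClass {g : ClassGroup (𝓞 K)} {v : HeightOneSpectrum (𝓞 K)} :
    v ∈ frobFiber ⊤ (primeClass (K := K)) g ↔ primeClass v = g := by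
  rw [mem_frobFiber]
  exact ⟨fun h ↦ h.2, fun h ↦ ⟨not_top_le v, h⟩⟩

/-- **The degree-one primes of every ideal class have divergent `∑ N𝔭^{-s}` at `s = 1`**:
`∑_{deg 𝔭 = 1, [𝔭] = g} N𝔭^{-s} → +∞` as `s → 1⁺` (it is `(1/h) log 1/(s−1) + O(1)`).
[cite: DavenportHeilbronn1936b, §4] -/
theorem tendsto_primeSeries_primeClass_atTop (g : ClassGroup (𝓞 K)) :
    Tendsto (fun s : ℝ ↦ primeSeries (fun p ↦ (primeNormCount K (frobFiber ⊤ (primeClass (K := K)) g) p : ℝ)) s)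
      (𝓝[>] 1) atTop := by
  obtain ⟨L, hL⟩ := hasStrongDirichletDensity_primeClass (K := K) g
  have hcard : (0 : ℝ) < 1 / (Nat.card (ClassGroup (𝓞 K)) : ℝ) := by
    have : (0 : ℝ) < Nat.card (ClassGroup (𝓞 K)) := Nat.cast_pos.mpr Nat.card_pos
    positivity
  -- `-(1/h) log (s-1) → +∞`
  have hlog : Tendsto (fun s : ℝ ↦ -(1 / (Nat.card (ClassGroup (𝓞 K)) : ℝ)) * Real.log (s - 1))
      (𝓝[>] 1) atTop := by
    have h1 : Tendsto (fun s : ℝ ↦ s - 1) (𝓝[>] 1) (𝓝[>] 0) := by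
      refine tendsto_nhdsWithin_iff.2 ⟨?_, ?_⟩
      · have := ((continuous_sub_right (1 : ℝ)).tendsto (1 : ℝ))
        simp only [sub_self] at this
        exact this.mono_left nhdsWithin_le_nhds
      · filter_upwards [self_mem_nhdsWithin] with s hs
        exact Set.mem_Ioi.2 (by simp only [Set.mem_Ioi] at hs; linarith)
    have h2 : Tendsto (fun s : ℝ ↦ Real.log (s - 1)) (𝓝[>] 1) atBot :=
      Real.tendsto_log_nhdsGT_zero.comp h1
    exact h2.const_mul_atBot_of_neg (neg_lt_zero.2 hcard)
  have h := hL.add_atTop hlog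
  refine h.congr' ?_
  filter_upwards with s
  ring

end DHEpstein

end Literature.Barriers.RiemannHypothesis
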